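import Literature.AlgebraicGeometry.Resolution.KrullAkizukiLemma

/-!
# `RisoCurves` (stmt-ResolutionOfSingularities-18550), Part B.1: a uniform bound on descending
# value chains over a one-dimensional Noetherian domain (finite Krull–Akizuki)

Route `ResolutionOfSingularities/RisoStrata`, support item `RisoCurves`. The tree's
`Literature.AlgebraicGeometry.Resolution.not_strictMono_valuation_of_krullDimLE_one`
(`KrullAkizukiLemma.lean`, Abhyankar 1956 Thm. 1 / Matsumura Thm. 11.7) forbids INFINITE sequences
`f₀, f₁, … ∈ W` with `v(d) ≤ v(f₀) < v(f₁) < ⋯` for a valuation ring `W ⊇ S` of `K = Frac S`,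
`S` Noetherian of dimension `≤ 1`, `0 ≠ d ∈ S`. Its proof in fact bounds FINITE such chains by the
length `l(S/dS)`; this file records that uniform form (`no_chain_of_length_eq`,
`chain_length_le_length`), which is what makes ONE blow-up schedule work for all valuation rings
at once in `RisoCurves`: the chain `f₀, …, f_{n+1}` spans an `S`-module `E ⊆ W` with
`l(E/dE) = l(S/dS) = n` (`length_quotSMulTop_eq_of_fg`) in which the cuts `E ∩ {v ≤ v(fᵢ)} + dE`
strictly increase. The proof is the tree's, with the infinite sequence replaced by a finite one.
-/

noncomputable section

set_option linter.dupNamespace false -- mandated namespace of this single-conjunct summit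

namespace Summit.ResolutionOfSingularities.ResolutionOfSingularities.Theorems

open Literature.AlgebraicGeometry.Resolution Pointwise

universe u v

variable {S : Type u} [CommRing S] [IsDomain S] {K : Type v} [Field K] [Algebra S K]
  [IsFractionRing S K]

/-- **Finite Krull–Akizuki chain bound.** Let `S` be a Noetherian domain of dimension `≤ 1` with
fraction field `K`, `W` a valuation ring of `K` containing `S`, `0 ≠ d ∈ S` with `l(S/dS) = n`.
There is no chain `f₀, …, f_{n+1} ∈ W` with `v(d) ≤ v(f₀) < v(f₁) < ⋯ < v(f_{n+1})` (Mathlib's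
multiplicative notation); the finite form of Matsumura Thm. 11.7 / Abhyankar 1956 Thm. 1 as proved
in the tree's `KrullAkizukiLemma.lean`. -/
theorem no_chain_of_length_eq [IsNoetherianRing S] [Ring.KrullDimLE 1 S]
    (W : ValuationSubring K) (hSW : ∀ s : S, algebraMap S K s ∈ W) {d : S} (hd : d ≠ 0)
    {n : ℕ} (hn : Module.length S (S ⧸ Ideal.span {d}) = n)
    (f : ℕ → K) (hfW : ∀ i, i ≤ n + 1 → f i ∈ W)
    (hdf : W.valuation (algebraMap S K d) ≤ W.valuation (f 0))
    (hmono : ∀ i, i ≤ n → W.valuation (f i) < W.valuation (f (i + 1))) : False := by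
  classical
  -- monotonicity of the values on `[0, n+1]`
  have hle : ∀ i j : ℕ, i ≤ j → j ≤ n + 1 → W.valuation (f i) ≤ W.valuation (f j) := by
    intro i j hij hj
    induction j with
    | zero =>
      rw [Nat.le_zero.mp hij]
    | succ j ih =>
      rcases Nat.lt_or_eq_of_le hij with h | h
      · exact (ih (Nat.lt_succ_iff.mp h) (by omega)).trans (hmono j (by omega)).le
      · rw [h]
  -- the `S`-submodules `{g ∈ W | v(g) ≤ γ}` of `K`
  let I : W.ValueGroup → Submodule S K := fun γ =>
    { carrier := {g | g ∈ W ∧ W.valuation g ≤ γ}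
      add_mem' := by
        rintro a b ⟨haW, ha⟩ ⟨hbW, hb⟩
        exact ⟨W.add_mem _ _ haW hbW, (Valuation.map_add _ a b).trans (max_le ha hb)⟩
      zero_mem' := ⟨W.zero_mem, by simp⟩
      smul_mem' := by
        rintro c x ⟨hxW, hx⟩
        refine ⟨?_, ?_⟩
        · rw [Algebra.smul_def]; exact W.mul_mem _ _ (hSW c) hxW
        · rw [Algebra.smul_def, map_mul]
          calc W.valuation (algebraMap S K c) * W.valuation x ≤ 1 * γ :=
                mul_le_mul' ((W.valuation_le_one_iff _).mpr (hSW c)) hx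
            _ = γ := one_mul γ }
  have hI : ∀ γ g, g ∈ I γ ↔ g ∈ W ∧ W.valuation g ≤ γ := fun γ g => Iff.rfl
  -- `E = span {f 0, …, f (n+1)}`
  set E : Submodule S K := Submodule.span S (Set.range fun i : Fin (n + 2) => f i) with hE
  have hEfg : E.FG := ⟨(Finset.univ : Finset (Fin (n + 2))).image fun i : Fin (n + 2) => f i, by
    rw [Finset.coe_image, Finset.coe_univ, Set.image_univ]⟩
  have hfE : ∀ i : Fin (n + 2), f i ∈ E := fun i => Submodule.subset_span ⟨i, rfl⟩
  have hEW : ∀ g ∈ E, g ∈ W := by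
    have : E ≤ I 1 := by
      rw [hE, Submodule.span_le]
      rintro _ ⟨i, rfl⟩
      have hi : (i : ℕ) ≤ n + 1 := by omega
      exact ⟨hfW i hi, (W.valuation_le_one_iff _).mpr (hfW i hi)⟩
    exact fun g hg => ((hI 1 g).mp (this hg)).1
  have hf1 : f 1 ≠ 0 := by
    intro h
    have := hmono 0 (Nat.zero_le n)
    rw [zero_add, h, map_zero] at this
    exact not_lt_of_ge zero_le this
  have hE0 : E ≠ ⊥ := by
    rw [Submodule.ne_bot_iff]
    exact ⟨f 1, hfE ⟨1, by omega⟩, hf1⟩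
  have hlen : Module.length S (QuotSMulTop d E) = n := by
    rw [length_quotSMulTop_eq_of_fg E hEfg hE0 hd, ← hn]
  -- the chain `A i = image of E ∩ {v ≤ v(f i)}` in `E/dE`
  let A : Fin (n + 2) → Submodule S (QuotSMulTop d E) := fun i =>
    Submodule.map (d • (⊤ : Submodule S E)).mkQ
      (Submodule.comap E.subtype (I (W.valuation (f i))))
  have hA : ∀ i : Fin (n + 1), A i.castSucc < A i.succ := by
    intro i
    have hival : (i : ℕ) ≤ n := by omega
    refine lt_of_le_of_ne ?_ ?_
    · refine Submodule.map_mono (Submodule.comap_mono ?_)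
      rintro g ⟨hgW, hg⟩
      refine ⟨hgW, hg.trans ?_⟩
      have := hle i (i + 1) (Nat.le_succ _) (by omega)
      simpa [Fin.val_succ] using this
    · intro heq
      -- `f (i+1)` lies in `A (i+1)`, hence in `A i`: `f (i+1) = a + d e`, `v(a) ≤ v(f i)`
      have hmem : (d • (⊤ : Submodule S E)).mkQ ⟨f i.succ, hfE i.succ⟩ ∈ A i.succ :=
        Submodule.mem_map_of_mem ⟨hfW _ (by simp [Fin.val_succ]; omega), le_rfl⟩
      rw [← heq] at hmem
      obtain ⟨a, ⟨haW, ha⟩, hea⟩ := hmem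
      rw [Submodule.mkQ_apply, Submodule.mkQ_apply, Submodule.Quotient.eq,
        Submodule.mem_smul_pointwise_iff_exists] at hea
      obtain ⟨e, -, he⟩ := hea
      have hsum : f i.succ = (a : K) - d • (e : K) := by
        have := congrArg Subtype.val he
        simp only [SetLike.val_smul, AddSubgroupClass.coe_sub] at this
        rw [this]; ring
      have hde : W.valuation (d • (e : K)) ≤ W.valuation (f i.castSucc) := by
        rw [Algebra.smul_def, map_mul]
        calc W.valuation (algebraMap S K d) * W.valuation (e : K)
            ≤ W.valuation (f 0) * 1 :=
              mul_le_mul' hdf ((W.valuation_le_one_iff _).mpr (hEW _ e.2))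
          _ = W.valuation (f 0) := mul_one _
          _ ≤ W.valuation (f i.castSucc) := hle 0 i (Nat.zero_le _) (by omega)
      have hlt : W.valuation (f i.castSucc) < W.valuation (f i.succ) := by
        have := hmono i hival
        simpa [Fin.val_succ] using this
      have : W.valuation (f i.succ) ≤ W.valuation (f i.castSucc) := by
        rw [hsum]
        exact (Valuation.map_sub _ _ _).trans (max_le ha hde)
      exact not_lt_of_ge this hlt
  -- a chain of length `n + 1` in a module of length `n`
  let p : LTSeries (Submodule S (QuotSMulTop d E)) :=
    LTSeries.mk (n + 1) A (Fin.strictMono_iff_lt_succ.mpr hA)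
  have h1 : ((n + 1 : ℕ) : WithBot ℕ∞) ≤ (Module.length S (QuotSMulTop d E) : WithBot ℕ∞) := by
    rw [Module.coe_length]
    exact Order.LTSeries.length_le_krullDim p
  rw [hlen] at h1
  have h2 : (n + 1 : ℕ) ≤ n := by exact_mod_cast h1
  omega

/-- **Uniform bound on strictly ascending value chains** (multiplicative notation; additively:
strictly decreasing values bounded by `v(d)`). With `S, K, W, d` as above, any chain
`f₀, …, f_m ∈ W` with `v(d) ≤ v(f₀) < ⋯ < v(f_m)` has `m ≤ l(S/dS)`, a bound depending on `d`
alone, not on `W` (corollary of `no_chain_of_length_eq`). -/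
theorem chain_length_le_length [IsNoetherianRing S] [Ring.KrullDimLE 1 S]
    (W : ValuationSubring K) (hSW : ∀ s : S, algebraMap S K s ∈ W) {d : S} (hd : d ≠ 0)
    (m : ℕ) (f : ℕ → K) (hfW : ∀ i, i ≤ m → f i ∈ W)
    (hdf : W.valuation (algebraMap S K d) ≤ W.valuation (f 0))
    (hmono : ∀ i, i < m → W.valuation (f i) < W.valuation (f (i + 1))) :
    (m : ℕ∞) ≤ Module.length S (S ⧸ Ideal.span {d}) := by
  obtain ⟨n, hn⟩ := ENat.ne_top_iff_exists.mp (length_quotient_span_singleton_ne_top hd)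
  rw [← hn]
  by_contra hlt
  have hmn : n + 1 ≤ m := by
    have : ¬ (m ≤ n) := fun h => hlt (by exact_mod_cast h)
    omega
  exact no_chain_of_length_eq W hSW hd hn.symm f (fun i hi => hfW i (hi.trans hmn)) hdf
    (fun i hi => hmono i (by omega))

end Summit.ResolutionOfSingularities.ResolutionOfSingularities.Theorems
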